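import Literature.Probability.RandomPlanarGeometry.BackwardLoewnerFlow
import Literature.Probability.RandomPlanarGeometry.SLERSObservableIto
import Literature.Probability.RandomPlanarGeometry.LoewnerInverseMeasurable
import HarnessLib

/-!
# The backward SLE_κ flow of a point: adaptedness, localization, stopped Itô form

Trunk T-STOCH; the process layer of the proof of Rohde–Schramm's derivative estimate Cor. 3.5
(`Literature.Probability.RandomPlanarGeometry.RohdeSchramm2005_cor35`) through a supermartingale
for the **backward** SLE flow (Rohde–Schramm, *Basic properties of SLE*, Ann. Math. 161 (2005),
§3.1, Thm. 3.2: "`M_u := ψ(u)^a F(z(u))` … is a local martingale"). For the SLE_κ driving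
function `U = √κ B` on the canonical space `(ℝ≥0 → ℝ, 𝓕ᵂ, preWienerMeasure)` and `w ∈ ℍ`, the
backward flow `hₜ(w)` (`Loewner.bwdFlow`, `BackwardLoewnerFlow.lean`) gives the real processes

* `bwdSLERe κ w t ω = Xₜ = re (hₜ(w) - Uₜ)`, `bwdSLEIm κ w t ω = Yₜ = im hₜ(w)` — continuous paths,
  adapted to the raw Brownian filtration (`Loewner.measurable_loewnerInv`: the backward flow at
  time `t` is a measurable functional of the path up to time `t`), progressive;
* `bwdSLEWeight κ w a lam t ω = Φₜ = exp ∫₀ᵗ (λ · 2/|Zₛ|² - a · 4Yₛ²/|Zₛ|⁴) ds = ψₜ^a (Yₜ/im w)^λ` —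
  the finite-variation factor of Rohde–Schramm's martingale `ψ^a (1 + X²/Y²)^b Y^λ`
  (`bwdSLEWeight_eq`), continuous, adapted, `Φₜ = 1 + ∫₀ᵗ rate · Φ`;
* the **localizing times** `bwdLocTime κ n = Sₙ ∧ (n+1)` (`Sₙ` the first time `|Uₜ| ≥ n+1`,
  `sleDrivingTime`): stopping times, `↑` in effect to `∞` (`exists_le_bwdLocTime`), before which
  `|U| ≤ n+1`, `im w ≤ Y ≤ √((im w)² + 4(n+1))`, `|X| ≤ |re w| + (n+1)/im w + (n+1)` and `Φ` is
  bounded above and below — no swallowing ever occurs for the backward flow, so, unlike the forward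
  case (`SLEPointFlow`), no localization in `Y` is needed;
* for a stopping time `σ ≤ bwdLocTime κ n`: the stopped processes `X^σ, Y^σ, Φ^σ`, their pathwise
  integral equations `X^σ_t = re w - ∫₀ᵗ 𝟙_{s≤σ} 2X/Q ds - √κ B_{t∧σ}`,
  `1/Y^σ_t = 1/im w - ∫₀ᵗ 𝟙_{s≤σ} 2/(YQ) ds`, `Φ^σ_t = 1 + ∫₀ᵗ 𝟙_{s≤σ} rate·Φ ds` (`Q = X² + Y²`),
  and **`X^σ` is an Itô process** driven by the canonical Brownian motion with drift
  `-𝟙_{s≤σ} 2X/Q` and diffusion coefficient `𝟙_{s≤σ}(-√κ)` (`isItoProcess_stoppedProcess_bwdSLERe`;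
  Rohde–Schramm's (3.11) `dx = 2x dt/(x² + y²) - dξ` in reversed time).

## References

* S. Rohde, O. Schramm, *Basic properties of SLE*, Ann. of Math. 161 (2005), §3.1, Lemma 3.1,
  Thm. 3.2 and its proof ((3.11)), Cor. 3.5.
* D. Revuz, M. Yor, *Continuous Martingales and Brownian Motion* (1999), Ch. I §4, Ch. IV §2–3.
-/

noncomputable section

open Set Filter MeasureTheory Metric Complex
open _root_.Topology
open scoped NNReal ENNReal

namespace Literature.Probability.RandomPlanarGeometry

open Loewner Literature.Probability.Process Literature.Analysis.FunctionSpaces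

variable (κ : ℝ≥0) (w : ℂ)

/-! ### The processes `X`, `Y` -/

/-- Rohde–Schramm's **`Xₜ = re(hₜ(w) - Uₜ)`** for the backward SLE_κ flow of `w` (driving function
`U = √κ B(ω)`), a real process on the canonical space. [cite: RohdeSchramm2005, Thm 3.2 (proof)] -/
def bwdSLERe (t : ℝ≥0) (ω : ℝ≥0 → ℝ) : ℝ :=
  (bwdCentred (sleDriving κ ω) w t).re

/-- Rohde–Schramm's **`Yₜ = im hₜ(w)`** for the backward SLE_κ flow of `w`, a real process on the
canonical space. [cite: RohdeSchramm2005, Thm 3.2 (proof)] -/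
def bwdSLEIm (t : ℝ≥0) (ω : ℝ≥0 → ℝ) : ℝ :=
  (bwdFlow (sleDriving κ ω) w t).im

variable {κ w}

/-- Unfolding of `bwdSLERe`. [folklore] -/
theorem bwdSLERe_apply (t : ℝ≥0) (ω : ℝ≥0 → ℝ) :
    bwdSLERe κ w t ω = (bwdFlow (sleDriving κ ω) w t).re - sleDriving κ ω t := by
  rw [bwdSLERe, re_bwdCentred]

/-- Unfolding of `bwdSLEIm`. [folklore] -/
theorem bwdSLEIm_apply (t : ℝ≥0) (ω : ℝ≥0 → ℝ) : bwdSLEIm κ w t ω = (bwdFlow (sleDriving κ ω) w t).im := rfl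

/-- `Yₜ = im Zₜ`. [folklore] -/
theorem bwdSLEIm_eq_im_bwdCentred (t : ℝ≥0) (ω : ℝ≥0 → ℝ) :
    bwdSLEIm κ w t ω = (bwdCentred (sleDriving κ ω) w t).im := by
  rw [bwdSLEIm_apply, im_bwdCentred]

/-- `X₀ = re w`, `U₀ = 0`. [folklore] -/
theorem bwdSLERe_zero (hw : 0 < w.im) (ω : ℝ≥0 → ℝ) : bwdSLERe κ w 0 ω = w.re := by
  rw [bwdSLERe_apply, bwdFlow_zero (continuous_sleDriving κ ω) hw, sleDriving_zero, sub_zero]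

/-- `Y₀ = im w`. [folklore] -/
theorem bwdSLEIm_zero (hw : 0 < w.im) (ω : ℝ≥0 → ℝ) : bwdSLEIm κ w 0 ω = w.im := by
  rw [bwdSLEIm_apply, bwdFlow_zero (continuous_sleDriving κ ω) hw]

/-- `im w ≤ Yₜ`. [folklore] -/
theorem im_le_bwdSLEIm (hw : 0 < w.im) (t : ℝ≥0) (ω : ℝ≥0 → ℝ) : w.im ≤ bwdSLEIm κ w t ω :=
  im_le_im_bwdFlow (continuous_sleDriving κ ω) hw t

/-- `0 < Yₜ`. [folklore] -/
theorem bwdSLEIm_pos (hw : 0 < w.im) (t : ℝ≥0) (ω : ℝ≥0 → ℝ) : 0 < bwdSLEIm κ w t ω :=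
  hw.trans_le (im_le_bwdSLEIm hw t ω)

/-- `X² + Y² = ‖Z‖²`. [folklore] -/
theorem sq_add_sq_eq_norm_sq (t : ℝ≥0) (ω : ℝ≥0 → ℝ) :
    bwdSLERe κ w t ω ^ 2 + bwdSLEIm κ w t ω ^ 2 = ‖bwdCentred (sleDriving κ ω) w t‖ ^ 2 := by
  rw [bwdSLERe, bwdSLEIm_eq_im_bwdCentred, re_sq_add_im_sq_eq_norm_sq]

/-- `0 < X² + Y²`. [folklore] -/
theorem sq_add_sq_pos (hw : 0 < w.im) (t : ℝ≥0) (ω : ℝ≥0 → ℝ) :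
    0 < bwdSLERe κ w t ω ^ 2 + bwdSLEIm κ w t ω ^ 2 := by
  have := bwdSLEIm_pos hw t ω (κ := κ)
  positivity

/-! ### Path regularity and adaptedness -/

/-- Every path of `X` is continuous. [folklore] -/
theorem continuous_bwdSLERe (hw : 0 < w.im) (ω : ℝ≥0 → ℝ) : Continuous fun t ↦ bwdSLERe κ w t ω :=
  Complex.continuous_re.comp (continuous_bwdCentred (continuous_sleDriving κ ω) hw)

/-- Every path of `Y` is continuous. [folklore] -/
theorem continuous_bwdSLEIm (hw : 0 < w.im) (ω : ℝ≥0 → ℝ) : Continuous fun t ↦ bwdSLEIm κ w t ω :=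
  Complex.continuous_im.comp (continuous_bwdFlow (continuous_sleDriving κ ω) hw)

/-- **The backward SLE flow at time `s` is `𝓕ᵂ_t`-measurable for `s ≤ t`**: `hₛ(w) = fₛ^{U(s-·)}(w)`
is a measurable functional of the reversed path `U(s - ·)`, whose values are values of `U` at times
`≤ s ≤ t` (`Loewner.measurable_loewnerInv`). Rohde–Schramm (2005), §3 p. 896.
[cite: RohdeSchramm2005, §3 p. 896] -/
theorem measurable_bwdFlow_sleDriving (κ : ℝ≥0) (hw : 0 < w.im) {s t : ℝ≥0} (hst : s ≤ t) :
    Measurable[brownianFiltration t] fun ω ↦ bwdFlow (sleDriving κ ω) w s :=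
  measurable_loewnerInv (mΩ := brownianFiltration t) (X := fun ω ↦ revDriver (sleDriving κ ω) s)
    (t := s) (fun ω ↦ continuous_revDriver (continuous_sleDriving κ ω) s)
    (fun r _ ↦ measurable_sleDriving_of_le κ ((tsub_le_self : s - r ≤ s).trans hst)) hw

/-- `X` is adapted to the raw Brownian filtration. [folklore] -/
theorem adapted_bwdSLERe (κ : ℝ≥0) (hw : 0 < w.im) : Adapted brownianFiltration (bwdSLERe κ w) := by
  intro t
  have h : bwdSLERe κ w t = fun ω ↦ (bwdFlow (sleDriving κ ω) w t).re - sleDriving κ ω t :=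
    funext fun ω ↦ bwdSLERe_apply t ω
  rw [h]
  exact (Complex.measurable_re.comp (measurable_bwdFlow_sleDriving κ hw le_rfl)).sub
    (measurable_sleDriving_of_le κ le_rfl)

/-- `Y` is adapted to the raw Brownian filtration. [folklore] -/
theorem adapted_bwdSLEIm (κ : ℝ≥0) (hw : 0 < w.im) : Adapted brownianFiltration (bwdSLEIm κ w) := fun t ↦
  Complex.measurable_im.comp (measurable_bwdFlow_sleDriving κ hw (le_refl t))

/-- `X` is strongly adapted. [folklore] -/
theorem stronglyAdapted_bwdSLERe (κ : ℝ≥0) (hw : 0 < w.im) : StronglyAdapted brownianFiltration (bwdSLERe κ w) :=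
  fun t ↦ (adapted_bwdSLERe κ hw t).stronglyMeasurable

/-- `Y` is strongly adapted. [folklore] -/
theorem stronglyAdapted_bwdSLEIm (κ : ℝ≥0) (hw : 0 < w.im) : StronglyAdapted brownianFiltration (bwdSLEIm κ w) :=
  fun t ↦ (adapted_bwdSLEIm κ hw t).stronglyMeasurable

/-- `X` is progressively measurable (adapted with continuous paths). [folklore] -/
theorem isStronglyProgressive_bwdSLERe (κ : ℝ≥0) (hw : 0 < w.im) :
    IsStronglyProgressive brownianFiltration (bwdSLERe κ w) :=
  (stronglyAdapted_bwdSLERe κ hw).isStronglyProgressive_of_continuous (continuous_bwdSLERe hw)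

/-- `Y` is progressively measurable. [folklore] -/
theorem isStronglyProgressive_bwdSLEIm (κ : ℝ≥0) (hw : 0 < w.im) :
    IsStronglyProgressive brownianFiltration (bwdSLEIm κ w) :=
  (stronglyAdapted_bwdSLEIm κ hw).isStronglyProgressive_of_continuous (continuous_bwdSLEIm hw)

/-! ### The rates and the finite-variation weight `Φ = ψ^a (Y/im w)^λ` -/

/-- The rate `2/(x² + y²)` of `log Y` (Rohde–Schramm's `∂ₜ u = -2|z|⁻²`, (3.9), sign reversed for the
backward flow). [cite: RohdeSchramm2005, eq. (3.9)] -/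
def loewnerLogImRate (x y : ℝ) : ℝ := 2 / (x ^ 2 + y ^ 2)

/-- Unfolding of `loewnerLogImRate`. [folklore] -/
theorem loewnerLogImRate_apply (x y : ℝ) : loewnerLogImRate x y = 2 / (x ^ 2 + y ^ 2) := rfl

/-- `loewnerLogImRate` is jointly measurable. [folklore] -/
theorem measurable_loewnerLogImRate : Measurable (Function.uncurry loewnerLogImRate) :=
  measurable_const.div ((measurable_fst.pow_const 2).add (measurable_snd.pow_const 2))

/-- `0 ≤ 2/(x² + y²)`. [folklore] -/
theorem loewnerLogImRate_nonneg (x y : ℝ) : 0 ≤ loewnerLogImRate x y := by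
  rw [loewnerLogImRate_apply]; positivity

/-- `2/(x² + y²) ≤ 2/y²`. [folklore] -/
theorem loewnerLogImRate_le {x y : ℝ} (hy : 0 < y) : loewnerLogImRate x y ≤ 2 / y ^ 2 := by
  rw [loewnerLogImRate_apply]
  exact div_le_div_of_nonneg_left zero_le_two (by positivity) (by nlinarith [sq_nonneg x])

variable (κ w) in
/-- The rate `λ · 2/|Z|² - a · 4Y²/|Z|⁴` of `log Φ` for Rohde–Schramm's exponents `a`, `λ`.
[cite: RohdeSchramm2005, Thm 3.2 (proof)] -/
def bwdSLEWeightRate (a lam : ℝ) (t : ℝ≥0) (ω : ℝ≥0 → ℝ) : ℝ :=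
  lam * loewnerLogImRate (bwdSLERe κ w t ω) (bwdSLEIm κ w t ω) -
    a * loewnerLogDerivRate (bwdSLERe κ w t ω) (bwdSLEIm κ w t ω)

variable (κ w) in
/-- Rohde–Schramm's finite-variation weight **`Φₜ = exp ∫₀ᵗ (λ · 2/|Zₛ|² - a · 4Yₛ²/|Zₛ|⁴) ds`**, equal to
`ψₜ^a (Yₜ/im w)^λ` (`bwdSLEWeight_eq`): the factor multiplying `(1 + Xₜ²/Yₜ²)^b` in the martingale
`ψ^a F̂(z)` of Thm. 3.2, normalised to `Φ₀ = 1`. [cite: RohdeSchramm2005, Thm 3.2 (proof)] -/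
def bwdSLEWeight (a lam : ℝ) (t : ℝ≥0) (ω : ℝ≥0 → ℝ) : ℝ :=
  Real.exp (timeIntegral (bwdSLEWeightRate κ w a lam) t ω)

/-- The rate of `log Y` along the backward SLE flow is `bwdLogImRate`. [folklore] -/
theorem loewnerLogImRate_eq_bwdLogImRate (t : ℝ≥0) (ω : ℝ≥0 → ℝ) :
    loewnerLogImRate (bwdSLERe κ w t ω) (bwdSLEIm κ w t ω) = bwdLogImRate (sleDriving κ ω) w t := by
  rw [loewnerLogImRate_apply, bwdLogImRate_apply, Real.toNNReal_coe, sq_add_sq_eq_norm_sq]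

/-- The `ψ`-rate along the backward SLE flow is `bwdPsiRate`. [folklore] -/
theorem loewnerLogDerivRate_eq_bwdPsiRate (t : ℝ≥0) (ω : ℝ≥0 → ℝ) :
    loewnerLogDerivRate (bwdSLERe κ w t ω) (bwdSLEIm κ w t ω) = bwdPsiRate (sleDriving κ ω) w t := by
  rw [loewnerLogDerivRate_apply, bwdPsiRate_apply, Real.toNNReal_coe, ← bwdSLEIm_eq_im_bwdCentred,
    sq_add_sq_eq_norm_sq]
  ring

/-- The weight rate read through the deterministic rates of `BackwardLoewnerFlow`. [folklore] -/
theorem bwdSLEWeightRate_eq (a lam : ℝ) (t : ℝ≥0) (ω : ℝ≥0 → ℝ) :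
    bwdSLEWeightRate κ w a lam t ω =
      lam * bwdLogImRate (sleDriving κ ω) w t - a * bwdPsiRate (sleDriving κ ω) w t := by
  rw [bwdSLEWeightRate, loewnerLogImRate_eq_bwdLogImRate, loewnerLogDerivRate_eq_bwdPsiRate]

/-- The weight rate in real time is continuous. [folklore] -/
theorem continuous_bwdSLEWeightRate_toNNReal (hw : 0 < w.im) (a lam : ℝ) (ω : ℝ≥0 → ℝ) :
    Continuous fun r : ℝ ↦ bwdSLEWeightRate κ w a lam r.toNNReal ω := by
  have hU := continuous_sleDriving κ ω
  have h1 : (fun r : ℝ ↦ bwdSLEWeightRate κ w a lam r.toNNReal ω) = fun r ↦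
      lam * bwdLogImRate (sleDriving κ ω) w r - a * bwdPsiRate (sleDriving κ ω) w r := by
    funext r
    rw [bwdSLEWeightRate_eq, bwdLogImRate_apply, bwdLogImRate_apply, bwdPsiRate_apply, bwdPsiRate_apply,
      Real.toNNReal_coe]
  rw [h1]
  exact (continuous_const.mul (continuous_bwdLogImRate hU hw)).sub
    (continuous_const.mul (continuous_bwdPsiRate hU hw))

/-- The weight rate is bounded: `|rate| ≤ (2|λ| + 4|a|)/(im w)²`. [folklore] -/
theorem abs_bwdSLEWeightRate_le (hw : 0 < w.im) (a lam : ℝ) (t : ℝ≥0) (ω : ℝ≥0 → ℝ) :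
    |bwdSLEWeightRate κ w a lam t ω| ≤ (2 * |lam| + 4 * |a|) / w.im ^ 2 := by
  have hU := continuous_sleDriving κ ω
  rw [bwdSLEWeightRate_eq]
  have h1 : |lam * bwdLogImRate (sleDriving κ ω) w t| ≤ |lam| * (2 / w.im ^ 2) := by
    rw [abs_mul]
    exact mul_le_mul_of_nonneg_left (by
      rw [abs_of_pos (bwdLogImRate_pos hU hw _)]; exact bwdLogImRate_le hU hw _) (abs_nonneg _)
  have h2 : |a * bwdPsiRate (sleDriving κ ω) w t| ≤ |a| * (4 / w.im ^ 2) := by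
    rw [abs_mul]
    exact mul_le_mul_of_nonneg_left (by
      rw [abs_of_nonneg (bwdPsiRate_nonneg _ _ _)]; exact bwdPsiRate_le hU hw _) (abs_nonneg _)
  calc |lam * bwdLogImRate (sleDriving κ ω) w t - a * bwdPsiRate (sleDriving κ ω) w t|
      ≤ |lam * bwdLogImRate (sleDriving κ ω) w t| + |a * bwdPsiRate (sleDriving κ ω) w t| := abs_sub _ _
    _ ≤ |lam| * (2 / w.im ^ 2) + |a| * (4 / w.im ^ 2) := add_le_add h1 h2
    _ = (2 * |lam| + 4 * |a|) / w.im ^ 2 := by ring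

/-- The weight rate is progressively measurable. [folklore] -/
theorem isStronglyProgressive_bwdSLEWeightRate (κ : ℝ≥0) (hw : 0 < w.im) (a lam : ℝ) :
    IsStronglyProgressive brownianFiltration (bwdSLEWeightRate κ w a lam) := by
  have hX := isStronglyProgressive_bwdSLERe κ hw
  have hY := isStronglyProgressive_bwdSLEIm κ hw
  have hF : Measurable (Function.uncurry fun x y : ℝ ↦ lam * loewnerLogImRate x y - a * loewnerLogDerivRate x y) :=
    (measurable_loewnerLogImRate.const_mul lam).sub (measurable_loewnerLogDerivRate.const_mul a)
  exact isStronglyProgressive_comp_pair hX hY hF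

/-- The weight-rate path is integrable on compact time intervals. [folklore] -/
theorem integrableOn_bwdSLEWeightRate (hw : 0 < w.im) (a lam : ℝ) (ω : ℝ≥0 → ℝ) (t : ℝ≥0) :
    IntegrableOn (fun r : ℝ ↦ bwdSLEWeightRate κ w a lam r.toNNReal ω) (Icc 0 t) :=
  (continuous_bwdSLEWeightRate_toNNReal hw a lam ω).continuousOn.integrableOn_compact isCompact_Icc

/-- **`Φₜ = ψₜ^a (Yₜ/im w)^λ`**: the weight is Rohde–Schramm's factor, by `ψₜ = exp(-∫ ψ-rate)`
(`Loewner.bwdPsi_eq_exp`) and `Yₜ = im w · exp ∫ 2/|Z|²` (`Loewner.im_bwdFlow_eq_mul_exp`).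
[cite: RohdeSchramm2005, Thm 3.2 (proof)] -/
theorem bwdSLEWeight_eq (hw : 0 < w.im) (a lam : ℝ) (t : ℝ≥0) (ω : ℝ≥0 → ℝ) :
    bwdSLEWeight κ w a lam t ω =
      (w.im / bwdSLEIm κ w t ω * ‖deriv (fun w ↦ bwdFlow (sleDriving κ ω) w t) w‖) ^ a *
        (bwdSLEIm κ w t ω / w.im) ^ lam := by
  have hU := continuous_sleDriving κ ω
  rw [bwdSLEWeight, bwdSLEIm_apply, bwdPsi_eq_exp hU t hw, im_bwdFlow_eq_mul_exp hU hw t,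
    mul_div_cancel_left₀ _ hw.ne', ← Real.exp_mul, ← Real.exp_mul, ← Real.exp_add]
  congr 1
  simp only [timeIntegral]
  have h1 : (fun r : ℝ ↦ bwdSLEWeightRate κ w a lam r.toNNReal ω) = fun r ↦
      lam * bwdLogImRate (sleDriving κ ω) w r - a * bwdPsiRate (sleDriving κ ω) w r := by
    funext r
    rw [bwdSLEWeightRate_eq, bwdLogImRate_apply, bwdLogImRate_apply, bwdPsiRate_apply, bwdPsiRate_apply,
      Real.toNNReal_coe]
  rw [h1, intervalIntegral.integral_sub ((continuous_bwdLogImRate hU hw).intervalIntegrable _ _ |>.const_mul lam)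
    ((continuous_bwdPsiRate hU hw).intervalIntegrable _ _ |>.const_mul a),
    intervalIntegral.integral_const_mul, intervalIntegral.integral_const_mul]
  ring

/-- `Φ₀ = 1`. [folklore] -/
theorem bwdSLEWeight_zero (a lam : ℝ) (ω : ℝ≥0 → ℝ) : bwdSLEWeight κ w a lam 0 ω = 1 := by
  rw [bwdSLEWeight, timeIntegral_apply_zero, Real.exp_zero]

/-- `0 < Φ`. [folklore] -/
theorem bwdSLEWeight_pos (a lam : ℝ) (t : ℝ≥0) (ω : ℝ≥0 → ℝ) : 0 < bwdSLEWeight κ w a lam t ω :=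
  Real.exp_pos _

/-- Every path of `Φ` is continuous. [folklore] -/
theorem continuous_bwdSLEWeight (hw : 0 < w.im) (a lam : ℝ) (ω : ℝ≥0 → ℝ) :
    Continuous fun t ↦ bwdSLEWeight κ w a lam t ω :=
  Real.continuous_exp.comp (continuous_timeIntegral (integrableOn_bwdSLEWeightRate hw a lam ω))

/-- `Φ` is strongly adapted (exponential of the time integral of a progressive rate). [folklore] -/
theorem stronglyAdapted_bwdSLEWeight (κ : ℝ≥0) (hw : 0 < w.im) (a lam : ℝ) :
    StronglyAdapted brownianFiltration (bwdSLEWeight κ w a lam) := fun t ↦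
  (Real.continuous_exp.measurable.comp
    (adapted_timeIntegral (isStronglyProgressive_bwdSLEWeightRate κ hw a lam) t)).stronglyMeasurable

/-- `Φ` is progressively measurable. [folklore] -/
theorem isStronglyProgressive_bwdSLEWeight (κ : ℝ≥0) (hw : 0 < w.im) (a lam : ℝ) :
    IsStronglyProgressive brownianFiltration (bwdSLEWeight κ w a lam) :=
  (stronglyAdapted_bwdSLEWeight κ hw a lam).isStronglyProgressive_of_continuous
    (continuous_bwdSLEWeight hw a lam)

/-- **`|log Φₜ| ≤ (2|λ| + 4|a|) t/(im w)²`.** [folklore] -/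
theorem abs_log_bwdSLEWeight_le (hw : 0 < w.im) (a lam : ℝ) (t : ℝ≥0) (ω : ℝ≥0 → ℝ) :
    |Real.log (bwdSLEWeight κ w a lam t ω)| ≤ (2 * |lam| + 4 * |a|) / w.im ^ 2 * t := by
  rw [bwdSLEWeight, Real.log_exp, timeIntegral]
  have h := intervalIntegral.norm_integral_le_of_norm_le_const (a := (0 : ℝ)) (b := (t : ℝ))
    (f := fun r : ℝ ↦ bwdSLEWeightRate κ w a lam r.toNNReal ω) (C := (2 * |lam| + 4 * |a|) / w.im ^ 2)
    fun r _ ↦ by rw [Real.norm_eq_abs]; exact abs_bwdSLEWeightRate_le hw a lam _ ω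
  rw [Real.norm_eq_abs, sub_zero, abs_of_nonneg t.coe_nonneg] at h
  exact h

/-- A generic calculus fact: **`exp ∫₀ᵗ g = 1 + ∫₀ᵗ g(s) exp(∫₀ˢ g) ds`** for continuous `g`.
[folklore] -/
theorem exp_integral_eq_one_add {g : ℝ → ℝ} (hg : Continuous g) (t : ℝ) :
    Real.exp (∫ s in (0 : ℝ)..t, g s) = 1 + ∫ s in (0 : ℝ)..t, g s * Real.exp (∫ r in (0 : ℝ)..s, g r) := by
  set F : ℝ → ℝ := fun s ↦ Real.exp (∫ r in (0 : ℝ)..s, g r) with hF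
  have hI : ∀ s, HasDerivAt (fun s ↦ ∫ r in (0 : ℝ)..s, g r) (g s) s := fun s ↦
    hg.integral_hasStrictDerivAt 0 s |>.hasDerivAt
  have hderiv : ∀ s, HasDerivAt F (g s * F s) s := fun s ↦ by
    have := (hI s).exp
    simpa [hF, mul_comm] using this
  have hFc : Continuous F := continuous_iff_continuousAt.2 fun s ↦ (hderiv s).continuousAt
  have hFTC := intervalIntegral.integral_eq_sub_of_hasDerivAt (fun s _ ↦ hderiv s)
    ((hg.mul hFc).intervalIntegrable 0 t)
  have hF0 : F 0 = 1 := by simp [hF]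
  rw [hF0] at hFTC
  change F t = 1 + ∫ s in (0 : ℝ)..t, g s * F s
  linarith

/-- **`Φₜ = 1 + ∫₀ᵗ rateₛ Φₛ ds`** (pathwise; `Φ` is `C¹` in time). [cite: RohdeSchramm2005, Thm 3.2 (proof)] -/
theorem bwdSLEWeight_eq_one_add (hw : 0 < w.im) (a lam : ℝ) (t : ℝ≥0) (ω : ℝ≥0 → ℝ) :
    bwdSLEWeight κ w a lam t ω = 1 + timeIntegral
      (fun s ω ↦ bwdSLEWeightRate κ w a lam s ω * bwdSLEWeight κ w a lam s ω) t ω := by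
  have hg := continuous_bwdSLEWeightRate_toNNReal hw a lam ω (κ := κ)
  rw [bwdSLEWeight, timeIntegral, exp_integral_eq_one_add hg t, timeIntegral]
  congr 1
  refine intervalIntegral.integral_congr fun s hs ↦ ?_
  rw [uIcc_of_le t.coe_nonneg] at hs
  simp only [bwdSLEWeight, timeIntegral, Real.coe_toNNReal _ hs.1]

/-! ### `1/Y` in integrated form (deterministic supplement to `BackwardLoewnerFlow`) -/

namespace Loewner

variable {U : ℝ≥0 → ℝ} {w : ℂ}

/-- **`1/Yₜ = 1/im w - ∫₀ᵗ 2/(Yₛ ‖Zₛ‖²) ds`** along the backward flow (`(1/Y)˙ = -Ẏ/Y² = -2/(Y|Z|²)`).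
[cite: RohdeSchramm2005, Thm 3.2 (proof, (3.11))] -/
theorem inv_im_bwdFlow_eq (hU : Continuous U) (hw : 0 < w.im) (t : ℝ≥0) :
    ((bwdFlow U w t).im)⁻¹ = (w.im)⁻¹ -
      ∫ s in (0 : ℝ)..t, 2 / ((bwdCentred U w s.toNNReal).im * ‖bwdCentred U w s.toNNReal‖ ^ 2) := by
  set G : ℝ → ℝ := fun r ↦ ((bwdPath U w r).im)⁻¹ with hG
  set G' : ℝ → ℝ := fun r ↦ -(2 / ((bwdCentred U w r.toNNReal).im * ‖bwdCentred U w r.toNNReal‖ ^ 2))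
    with hG'
  have hZc := continuous_bwdCentred_toNNReal hU hw
  have hpos : ∀ r, 0 < (bwdPath U w r).im := fun r ↦ im_bwdFlow_pos hU hw _
  have hy' : ∀ r : ℝ, (bwdCentred U w r.toNNReal).im = (bwdPath U w r).im := fun r ↦ by
    rw [im_bwdCentred, bwdPath_apply]
  have hcont : ContinuousOn G (Icc 0 t) :=
    ((Complex.continuous_im.comp (continuous_bwdPath hU hw)).continuousOn).inv₀ fun r _ ↦ (hpos r).ne'
  have hderiv : ∀ r ∈ Ioo (0 : ℝ) t, HasDerivAt G (G' r) r := by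
    intro r hr
    have h1 := (hasDerivAt_im_bwdPath hU hw hr.1).inv (hpos r).ne'
    refine h1.congr_deriv ?_
    have hy : (bwdPath U w r).im ≠ 0 := (hpos r).ne'
    have hn : ‖bwdCentred U w r.toNNReal‖ ^ 2 ≠ 0 := pow_ne_zero 2 (norm_bwdCentred_pos hU hw _).ne'
    simp only [hG', hy']
    field_simp
  have hcont' : Continuous G' := by
    refine (continuous_const.div ((Complex.continuous_im.comp hZc).mul (hZc.norm.pow 2)) fun r ↦ ?_).neg
    exact mul_ne_zero (im_bwdCentred_pos hU hw _).ne' (pow_ne_zero 2 (norm_bwdCentred_pos hU hw _).ne')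
  have hFTC := intervalIntegral.integral_eq_sub_of_hasDerivAt_of_le (NNReal.coe_nonneg t) hcont hderiv
    (hcont'.intervalIntegrable _ _)
  have hG0 : G 0 = (w.im)⁻¹ := by
    simp only [hG]; rw [bwdPath_of_nonpos hU hw le_rfl]
  have hGt : G t = ((bwdFlow U w t).im)⁻¹ := by simp only [hG, bwdPath_coe]
  rw [hG0, hGt] at hFTC
  simp only [hG', intervalIntegral.integral_neg] at hFTC
  linarith

/-- `|2 re Z/‖Z‖²| ≤ 1/im Z` for `im Z > 0` (`2|re Z| im Z ≤ ‖Z‖²`). [folklore] -/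
theorem abs_two_mul_re_div_norm_sq_le {Z : ℂ} (hZ : 0 < Z.im) : |2 * Z.re / ‖Z‖ ^ 2| ≤ 1 / Z.im := by
  have hsq : ‖Z‖ ^ 2 = Z.re ^ 2 + Z.im ^ 2 := (re_sq_add_im_sq_eq_norm_sq Z).symm
  have hn : 0 < ‖Z‖ ^ 2 := by rw [hsq]; positivity
  rw [abs_div, abs_of_pos hn, div_le_div_iff₀ hn hZ, abs_mul, abs_two, one_mul, hsq]
  nlinarith [sq_abs Z.re, sq_nonneg (|Z.re| - Z.im), abs_nonneg Z.re]

/-- **`|re hₜ(w) - re w| ≤ t/im w`** (`|∂ re h| = |2X/|Z|²| ≤ 1/Y ≤ 1/im w`). [folklore] -/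
theorem abs_re_bwdFlow_sub_le (hU : Continuous U) (hw : 0 < w.im) (t : ℝ≥0) :
    |(bwdFlow U w t).re - w.re| ≤ t / w.im := by
  rw [re_bwdFlow_eq hU hw t, sub_sub_cancel_left, abs_neg]
  have h := intervalIntegral.norm_integral_le_of_norm_le_const (a := (0 : ℝ)) (b := (t : ℝ))
    (f := fun s : ℝ ↦ 2 * (bwdCentred U w s.toNNReal).re / ‖bwdCentred U w s.toNNReal‖ ^ 2)
    (C := 1 / w.im) fun s _ ↦ by
      rw [Real.norm_eq_abs]
      refine (abs_two_mul_re_div_norm_sq_le (im_bwdCentred_pos hU hw _)).trans ?_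
      exact div_le_div_of_nonneg_left zero_le_one hw
        ((im_le_im_bwdFlow hU hw _).trans_eq (im_bwdCentred U w _).symm)
  rw [Real.norm_eq_abs, sub_zero, abs_of_nonneg t.coe_nonneg] at h
  calc |∫ s in (0 : ℝ)..t, 2 * (bwdCentred U w s.toNNReal).re / ‖bwdCentred U w s.toNNReal‖ ^ 2|
      ≤ 1 / w.im * t := h
    _ = t / w.im := by ring

end Loewner

/-! ### Localizing stopping times -/

variable (κ) in
/-- The **localizing stopping times** `ρₙ = Sₙ ∧ (n+1)` for the Itô calculus of the backward flow
(`Sₙ = sleDrivingTime κ n`, the first time `|Uₜ| ≥ n + 1`): before `ρₙ` all coefficients are bounded.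
(For the backward flow nothing is swallowed, so no localization in `Y` is needed.)
[cite: RohdeSchramm2005, Thm 3.2 (proof)] -/
def bwdLocTime (n : ℕ) (ω : ℝ≥0 → ℝ) : WithTop ℝ≥0 :=
  min (sleDrivingTime κ n ω) (((n : ℝ≥0) + 1 : ℝ≥0) : WithTop ℝ≥0)

/-- `ρₙ` is a stopping time of the raw Brownian filtration. [folklore] -/
theorem isStoppingTime_bwdLocTime (κ : ℝ≥0) (n : ℕ) : IsStoppingTime brownianFiltration (bwdLocTime κ n) :=
  (isStoppingTime_sleDrivingTime κ n).min (isStoppingTime_const _ _)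

/-- `ρₙ ≤ n + 1`. [folklore] -/
theorem bwdLocTime_le (n : ℕ) (ω : ℝ≥0 → ℝ) :
    bwdLocTime κ n ω ≤ (((n : ℝ≥0) + 1 : ℝ≥0) : WithTop ℝ≥0) := min_le_right _ _

/-- `ρₙ ≤ Sₙ`. [folklore] -/
theorem bwdLocTime_le_drivingTime (n : ℕ) (ω : ℝ≥0 → ℝ) : bwdLocTime κ n ω ≤ sleDrivingTime κ n ω :=
  min_le_left _ _

/-- `ρₙ < ⊤`. [folklore] -/
theorem bwdLocTime_ne_top (n : ℕ) (ω : ℝ≥0 → ℝ) : bwdLocTime κ n ω ≠ ⊤ :=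
  ne_top_of_le_ne_top WithTop.coe_ne_top (bwdLocTime_le n ω)

/-- Times before `ρₙ` are at most `n + 1`. [folklore] -/
theorem le_of_le_bwdLocTime {n : ℕ} {ω : ℝ≥0 → ℝ} {s : ℝ≥0} (hs : (s : WithTop ℝ≥0) ≤ bwdLocTime κ n ω) :
    (s : ℝ) ≤ n + 1 := by
  have := WithTop.coe_le_coe.1 (hs.trans (bwdLocTime_le n ω))
  exact_mod_cast this

/-- **Before `Sₙ` the driving function is bounded by `n + 1`.** [folklore] -/
theorem abs_sleDriving_le_of_le_drivingTime {n : ℕ} {ω : ℝ≥0 → ℝ} {s : ℝ≥0}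
    (hsS : (s : WithTop ℝ≥0) ≤ sleDrivingTime κ n ω) : |sleDriving κ ω s| ≤ n + 1 := by
  have hbefore : ∀ r : ℝ≥0, (r : WithTop ℝ≥0) < sleDrivingTime κ n ω → |sleDriving κ ω r| ≤ n + 1 :=
    fun r hr ↦ by
      have := notMem_of_coe_lt_hittingAfter_zero (u := fun t ω ↦ |sleDriving κ ω t|)
        (s := Ici ((n : ℝ) + 1)) hr
      exact (not_le.1 this).le
  rcases hsS.lt_or_eq with hlt | heq
  · exact hbefore s hlt
  · have hpos : 0 < s := by
      by_contra h0
      have hs0 : s = 0 := le_antisymm (not_lt.1 h0) bot_le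
      have hmem := mem_of_hittingAfter_zero_eq_coe (u := fun t ω ↦ |sleDriving κ ω t|) isClosed_Ici
        ((continuous_sleDriving κ ω).abs) heq.symm
      rw [hs0, mem_Ici, sleDriving_zero, abs_zero] at hmem
      linarith
    have h := le_apply_of_forall_lt (u := fun r ↦ -|sleDriving κ ω r|) ((continuous_sleDriving κ ω).abs.neg)
      (c := -((n : ℝ) + 1)) hpos fun r hr ↦ neg_le_neg (hbefore r (by rw [← heq]; exact_mod_cast hr))
    linarith

/-- **Before `ρₙ` the driving function is bounded by `n + 1`.** [folklore] -/
theorem abs_sleDriving_le_of_le_bwdLocTime {n : ℕ} {ω : ℝ≥0 → ℝ} {s : ℝ≥0}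
    (hs : (s : WithTop ℝ≥0) ≤ bwdLocTime κ n ω) : |sleDriving κ ω s| ≤ n + 1 :=
  abs_sleDriving_le_of_le_drivingTime (hs.trans (bwdLocTime_le_drivingTime n ω))

/-- `Sₙ` is non-decreasing in `n` (higher levels are hit later). [folklore] -/
theorem sleDrivingTime_mono (ω : ℝ≥0 → ℝ) : Monotone fun n ↦ sleDrivingTime κ n ω := by
  refine monotone_nat_of_le_succ fun n ↦ ?_
  induction hT : sleDrivingTime κ (n + 1) ω using WithTop.recTopCoe with
  | top => exact le_top
  | coe T =>
    have hmem := mem_of_hittingAfter_zero_eq_coe (u := fun t ω ↦ |sleDriving κ ω t|) isClosed_Ici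
      ((continuous_sleDriving κ ω).abs) hT
    refine hittingAfter_le_of_mem bot_le ?_
    simp only [mem_Ici, Nat.cast_add, Nat.cast_one] at hmem ⊢
    linarith

/-- **`ρₙ` is non-decreasing in `n`.** [folklore] -/
theorem bwdLocTime_mono (ω : ℝ≥0 → ℝ) : Monotone fun n ↦ bwdLocTime κ n ω := by
  intro n m hnm
  refine min_le_min (sleDrivingTime_mono ω hnm) ?_
  have h : (n : ℝ≥0) + 1 ≤ (m : ℝ≥0) + 1 := by gcongr
  exact_mod_cast h

/-- **The localizing times exhaust time**: every `t` is `≤ ρₙ` for `n` large (the driving path is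
bounded on `[0, t]`). [folklore] -/
theorem exists_le_bwdLocTime (ω : ℝ≥0 → ℝ) (t : ℝ≥0) : ∃ n : ℕ, (t : WithTop ℝ≥0) ≤ bwdLocTime κ n ω := by
  -- a bound for `|U|` on `[0, t]`
  obtain ⟨M, hM⟩ : ∃ M : ℝ, ∀ s ∈ Icc (0 : ℝ≥0) t, |sleDriving κ ω s| ≤ M := by
    obtain ⟨M, hM⟩ := isCompact_Icc.exists_bound_of_continuousOn
      ((continuous_sleDriving κ ω).continuousOn (s := Icc (0 : ℝ≥0) t))
    exact ⟨M, fun s hs ↦ by simpa [Real.norm_eq_abs] using hM s hs⟩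
  obtain ⟨n, hn⟩ := exists_nat_gt (max M (t : ℝ))
  refine ⟨n, le_min ?_ ?_⟩
  · -- `t < Sₙ`: `|U| < n + 1` on `[0, t]`
    by_contra h
    rw [not_le] at h
    obtain ⟨j, hjt, hj⟩ := (hittingAfter_zero_le_coe_iff (u := fun t ω ↦ |sleDriving κ ω t|) isClosed_Ici
      ((continuous_sleDriving κ ω).abs)).1 h.le
    have h1 := hM j ⟨bot_le, hjt⟩
    rw [mem_Ici] at hj
    linarith [le_max_left M (t : ℝ)]
  · have : (t : ℝ) ≤ (n : ℝ) + 1 := by linarith [le_max_right M (t : ℝ)]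
    exact_mod_cast this

/-! ### Bounds before `ρₙ` -/

/-- **`Yₛ ≤ √((im w)² + 4(n+1))` before `ρₙ`.** [folklore] -/
theorem bwdSLEIm_le_of_le_bwdLocTime (hw : 0 < w.im) {n : ℕ} {ω : ℝ≥0 → ℝ} {s : ℝ≥0}
    (hs : (s : WithTop ℝ≥0) ≤ bwdLocTime κ n ω) :
    bwdSLEIm κ w s ω ≤ Real.sqrt (w.im ^ 2 + 4 * ((n : ℝ) + 1)) := by
  have h1 := sq_im_bwdFlow_le (continuous_sleDriving κ ω) hw s
  have h2 := le_of_le_bwdLocTime hs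
  rw [bwdSLEIm_apply]
  refine Real.le_sqrt_of_sq_le ?_
  linarith

/-- **`|Xₛ| ≤ |re w| + (n+1)/im w + (n+1)` before `ρₙ`.** [folklore] -/
theorem abs_bwdSLERe_le_of_le_bwdLocTime (hw : 0 < w.im) {n : ℕ} {ω : ℝ≥0 → ℝ} {s : ℝ≥0}
    (hs : (s : WithTop ℝ≥0) ≤ bwdLocTime κ n ω) :
    |bwdSLERe κ w s ω| ≤ |w.re| + ((n : ℝ) + 1) / w.im + ((n : ℝ) + 1) := by
  have hU := continuous_sleDriving κ ω
  have h1 := abs_re_bwdFlow_sub_le hU hw s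
  have h2 := le_of_le_bwdLocTime hs
  have h3 := abs_sleDriving_le_of_le_bwdLocTime hs
  have h4 : (s : ℝ) / w.im ≤ ((n : ℝ) + 1) / w.im := div_le_div_of_nonneg_right h2 hw.le
  rw [bwdSLERe_apply]
  calc |(bwdFlow (sleDriving κ ω) w s).re - sleDriving κ ω s|
      ≤ |(bwdFlow (sleDriving κ ω) w s).re| + |sleDriving κ ω s| := abs_sub _ _
    _ ≤ (|w.re| + |(bwdFlow (sleDriving κ ω) w s).re - w.re|) + |sleDriving κ ω s| := by
        gcongr
        calc |(bwdFlow (sleDriving κ ω) w s).re| = |w.re + ((bwdFlow (sleDriving κ ω) w s).re - w.re)| := by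
              ring_nf
          _ ≤ |w.re| + |(bwdFlow (sleDriving κ ω) w s).re - w.re| := abs_add_le _ _
    _ ≤ |w.re| + ((n : ℝ) + 1) / w.im + ((n : ℝ) + 1) := by linarith

/-- **`|log Φₛ| ≤ (2|λ| + 4|a|)(n+1)/(im w)²` before `ρₙ`.** [folklore] -/
theorem abs_log_bwdSLEWeight_le_of_le_bwdLocTime (hw : 0 < w.im) (a lam : ℝ) {n : ℕ} {ω : ℝ≥0 → ℝ}
    {s : ℝ≥0} (hs : (s : WithTop ℝ≥0) ≤ bwdLocTime κ n ω) :
    |Real.log (bwdSLEWeight κ w a lam s ω)| ≤ (2 * |lam| + 4 * |a|) / w.im ^ 2 * ((n : ℝ) + 1) :=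
  (abs_log_bwdSLEWeight_le hw a lam s ω).trans
    (mul_le_mul_of_nonneg_left (le_of_le_bwdLocTime hs) (by positivity))


/-! ### Stopped processes below a localizing time -/

section Stopped

variable {n : ℕ} {σ : (ℝ≥0 → ℝ) → WithTop ℝ≥0}

/-- For `σ ≤ ρₙ`, the stopped clock `t ∧ σ` is at most `ρₙ`. [folklore] -/
theorem coe_untopA_min_le_bwdLocTime (hσρ : ∀ ω, σ ω ≤ bwdLocTime κ n ω) (t : ℝ≥0) (ω : ℝ≥0 → ℝ) :
    (((min (t : WithTop ℝ≥0) (σ ω)).untopA : ℝ≥0) : WithTop ℝ≥0) ≤ bwdLocTime κ n ω :=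
  (coe_untopA_min_le t (σ ω)).trans (hσρ ω)

/-- `X^σ_t = X_{t∧σ}` (`rfl`). [folklore] -/
theorem stoppedProcess_bwdSLERe_eq (t : ℝ≥0) (ω : ℝ≥0 → ℝ) :
    stoppedProcess (bwdSLERe κ w) σ t ω = bwdSLERe κ w ((min (t : WithTop ℝ≥0) (σ ω)).untopA) ω := rfl

/-- `Y^σ_t = Y_{t∧σ}` (`rfl`). [folklore] -/
theorem stoppedProcess_bwdSLEIm_eq (t : ℝ≥0) (ω : ℝ≥0 → ℝ) :
    stoppedProcess (bwdSLEIm κ w) σ t ω = bwdSLEIm κ w ((min (t : WithTop ℝ≥0) (σ ω)).untopA) ω := rfl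

/-- `Φ^σ_t = Φ_{t∧σ}` (`rfl`). [folklore] -/
theorem stoppedProcess_bwdSLEWeight_eq (a lam : ℝ) (t : ℝ≥0) (ω : ℝ≥0 → ℝ) :
    stoppedProcess (bwdSLEWeight κ w a lam) σ t ω =
      bwdSLEWeight κ w a lam ((min (t : WithTop ℝ≥0) (σ ω)).untopA) ω := rfl

/-- `X^σ_0 = re w`. [folklore] -/
theorem stoppedProcess_bwdSLERe_zero (hw : 0 < w.im) (ω : ℝ≥0 → ℝ) :
    stoppedProcess (bwdSLERe κ w) σ 0 ω = w.re := by
  rw [stoppedProcess_eq_of_le (by exact_mod_cast bot_le : ((0 : ℝ≥0) : WithTop ℝ≥0) ≤ σ ω),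
    bwdSLERe_zero hw]

/-- `Y^σ_0 = im w`. [folklore] -/
theorem stoppedProcess_bwdSLEIm_zero (hw : 0 < w.im) (ω : ℝ≥0 → ℝ) :
    stoppedProcess (bwdSLEIm κ w) σ 0 ω = w.im := by
  rw [stoppedProcess_eq_of_le (by exact_mod_cast bot_le : ((0 : ℝ≥0) : WithTop ℝ≥0) ≤ σ ω),
    bwdSLEIm_zero hw]

/-- `Φ^σ_0 = 1`. [folklore] -/
theorem stoppedProcess_bwdSLEWeight_zero (a lam : ℝ) (ω : ℝ≥0 → ℝ) :
    stoppedProcess (bwdSLEWeight κ w a lam) σ 0 ω = 1 := by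
  rw [stoppedProcess_eq_of_le (by exact_mod_cast bot_le : ((0 : ℝ≥0) : WithTop ℝ≥0) ≤ σ ω),
    bwdSLEWeight_zero]

/-- `0 < Y^σ`. [folklore] -/
theorem stoppedProcess_bwdSLEIm_pos (hw : 0 < w.im) (t : ℝ≥0) (ω : ℝ≥0 → ℝ) :
    0 < stoppedProcess (bwdSLEIm κ w) σ t ω := bwdSLEIm_pos hw _ ω

/-- `im w ≤ Y^σ`. [folklore] -/
theorem im_le_stoppedProcess_bwdSLEIm (hw : 0 < w.im) (t : ℝ≥0) (ω : ℝ≥0 → ℝ) :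
    w.im ≤ stoppedProcess (bwdSLEIm κ w) σ t ω := im_le_bwdSLEIm hw _ ω

/-- `Y^σ ≤ √((im w)² + 4(n+1))` for `σ ≤ ρₙ`. [folklore] -/
theorem stoppedProcess_bwdSLEIm_le (hw : 0 < w.im) (hσρ : ∀ ω, σ ω ≤ bwdLocTime κ n ω) (t : ℝ≥0)
    (ω : ℝ≥0 → ℝ) : stoppedProcess (bwdSLEIm κ w) σ t ω ≤ Real.sqrt (w.im ^ 2 + 4 * ((n : ℝ) + 1)) :=
  bwdSLEIm_le_of_le_bwdLocTime hw (coe_untopA_min_le_bwdLocTime hσρ t ω)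

/-- `|X^σ| ≤ |re w| + (n+1)/im w + (n+1)` for `σ ≤ ρₙ`. [folklore] -/
theorem abs_stoppedProcess_bwdSLERe_le (hw : 0 < w.im) (hσρ : ∀ ω, σ ω ≤ bwdLocTime κ n ω) (t : ℝ≥0)
    (ω : ℝ≥0 → ℝ) :
    |stoppedProcess (bwdSLERe κ w) σ t ω| ≤ |w.re| + ((n : ℝ) + 1) / w.im + ((n : ℝ) + 1) :=
  abs_bwdSLERe_le_of_le_bwdLocTime hw (coe_untopA_min_le_bwdLocTime hσρ t ω)

/-- `0 < Φ^σ`. [folklore] -/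
theorem stoppedProcess_bwdSLEWeight_pos (a lam : ℝ) (t : ℝ≥0) (ω : ℝ≥0 → ℝ) :
    0 < stoppedProcess (bwdSLEWeight κ w a lam) σ t ω := bwdSLEWeight_pos a lam _ ω

/-- `|Φ^σ| ≤ exp((2|λ| + 4|a|)(n+1)/(im w)²)` for `σ ≤ ρₙ`. [folklore] -/
theorem abs_stoppedProcess_bwdSLEWeight_le (hw : 0 < w.im) (hσρ : ∀ ω, σ ω ≤ bwdLocTime κ n ω)
    (a lam : ℝ) (t : ℝ≥0) (ω : ℝ≥0 → ℝ) :
    |stoppedProcess (bwdSLEWeight κ w a lam) σ t ω| ≤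
      Real.exp ((2 * |lam| + 4 * |a|) / w.im ^ 2 * ((n : ℝ) + 1)) := by
  have hpos := stoppedProcess_bwdSLEWeight_pos a lam t ω (κ := κ) (w := w) (σ := σ)
  rw [abs_of_pos hpos, ← Real.exp_log hpos, Real.exp_le_exp]
  exact (le_abs_self _).trans
    (abs_log_bwdSLEWeight_le_of_le_bwdLocTime hw a lam (coe_untopA_min_le_bwdLocTime hσρ t ω))

/-- Every path of `X^σ` is continuous. [folklore] -/
theorem continuous_stoppedProcess_bwdSLERe (hw : 0 < w.im) (σ : (ℝ≥0 → ℝ) → WithTop ℝ≥0)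
    (ω : ℝ≥0 → ℝ) : Continuous fun t ↦ stoppedProcess (bwdSLERe κ w) σ t ω :=
  continuous_stoppedProcess_path (continuous_bwdSLERe hw ω) σ

/-- Every path of `Y^σ` is continuous. [folklore] -/
theorem continuous_stoppedProcess_bwdSLEIm (hw : 0 < w.im) (σ : (ℝ≥0 → ℝ) → WithTop ℝ≥0)
    (ω : ℝ≥0 → ℝ) : Continuous fun t ↦ stoppedProcess (bwdSLEIm κ w) σ t ω :=
  continuous_stoppedProcess_path (continuous_bwdSLEIm hw ω) σ

/-- Every path of `Φ^σ` is continuous. [folklore] -/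
theorem continuous_stoppedProcess_bwdSLEWeight (hw : 0 < w.im) (a lam : ℝ)
    (σ : (ℝ≥0 → ℝ) → WithTop ℝ≥0) (ω : ℝ≥0 → ℝ) :
    Continuous fun t ↦ stoppedProcess (bwdSLEWeight κ w a lam) σ t ω :=
  continuous_stoppedProcess_path (continuous_bwdSLEWeight hw a lam ω) σ

/-- `X^σ` is progressively measurable for a stopping time `σ`. [folklore] -/
theorem isStronglyProgressive_stoppedProcess_bwdSLERe (hw : 0 < w.im)
    (hσ : IsStoppingTime brownianFiltration σ) :
    IsStronglyProgressive brownianFiltration (stoppedProcess (bwdSLERe κ w) σ) :=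
  (isStronglyProgressive_bwdSLERe κ hw).stoppedProcess hσ

/-- `Y^σ` is progressively measurable for a stopping time `σ`. [folklore] -/
theorem isStronglyProgressive_stoppedProcess_bwdSLEIm (hw : 0 < w.im)
    (hσ : IsStoppingTime brownianFiltration σ) :
    IsStronglyProgressive brownianFiltration (stoppedProcess (bwdSLEIm κ w) σ) :=
  (isStronglyProgressive_bwdSLEIm κ hw).stoppedProcess hσ

/-- `Φ^σ` is progressively measurable for a stopping time `σ`. [folklore] -/
theorem isStronglyProgressive_stoppedProcess_bwdSLEWeight (hw : 0 < w.im) (a lam : ℝ)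
    (hσ : IsStoppingTime brownianFiltration σ) :
    IsStronglyProgressive brownianFiltration (stoppedProcess (bwdSLEWeight κ w a lam) σ) :=
  (isStronglyProgressive_bwdSLEWeight κ hw a lam).stoppedProcess hσ

/-- `X^σ` is strongly adapted. [folklore] -/
theorem stronglyAdapted_stoppedProcess_bwdSLERe (hw : 0 < w.im) (hσ : IsStoppingTime brownianFiltration σ) :
    StronglyAdapted brownianFiltration (stoppedProcess (bwdSLERe κ w) σ) :=
  (isStronglyProgressive_stoppedProcess_bwdSLERe hw hσ).stronglyAdapted

/-- `Y^σ` is strongly adapted. [folklore] -/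
theorem stronglyAdapted_stoppedProcess_bwdSLEIm (hw : 0 < w.im) (hσ : IsStoppingTime brownianFiltration σ) :
    StronglyAdapted brownianFiltration (stoppedProcess (bwdSLEIm κ w) σ) :=
  (isStronglyProgressive_stoppedProcess_bwdSLEIm hw hσ).stronglyAdapted

/-- `Φ^σ` is strongly adapted. [folklore] -/
theorem stronglyAdapted_stoppedProcess_bwdSLEWeight (hw : 0 < w.im) (a lam : ℝ)
    (hσ : IsStoppingTime brownianFiltration σ) :
    StronglyAdapted brownianFiltration (stoppedProcess (bwdSLEWeight κ w a lam) σ) :=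
  (isStronglyProgressive_stoppedProcess_bwdSLEWeight hw a lam hσ).stronglyAdapted

/-! ### Pathwise integral equations for `X^σ`, `1/Y^σ`, `Φ^σ` -/

/-- **`X^σ_t = re w - ∫₀ᵗ 𝟙_{s≤σ} 2Xₛ/Qₛ ds - √κ B_{t∧σ}`** (pathwise): the real part of the backward
equation integrated (`Loewner.re_bwdFlow_eq`) at the stopped clock, `U = √κ B`. Rohde–Schramm (2005),
(3.11). [cite: RohdeSchramm2005, Thm 3.2 (proof, (3.11))] -/
theorem stoppedProcess_bwdSLERe_eq_integral (hw : 0 < w.im) (t : ℝ≥0) (ω : ℝ≥0 → ℝ) :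
    stoppedProcess (bwdSLERe κ w) σ t ω =
      w.re + timeIntegral (trunc σ fun s ω ↦ -loewnerReDrift (stoppedProcess (bwdSLERe κ w) σ s ω)
        (stoppedProcess (bwdSLEIm κ w) σ s ω)) t ω +
      -Real.sqrt κ * brownian ((min (t : WithTop ℝ≥0) (σ ω)).untopA) ω := by
  set u : ℝ≥0 := (min (t : WithTop ℝ≥0) (σ ω)).untopA with hu
  have hU := continuous_sleDriving κ ω
  have hint : timeIntegral (trunc σ fun s ω ↦ -loewnerReDrift (stoppedProcess (bwdSLERe κ w) σ s ω)
      (stoppedProcess (bwdSLEIm κ w) σ s ω)) t ω =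
      ∫ r in (0 : ℝ)..u, -(2 * (bwdCentred (sleDriving κ ω) w r.toNNReal).re /
        ‖bwdCentred (sleDriving κ ω) w r.toNNReal‖ ^ 2) := by
    rw [timeIntegral_trunc]
    simp only [timeIntegral]
    refine intervalIntegral.integral_congr fun r hr ↦ ?_
    rw [uIcc_of_le (NNReal.coe_nonneg _)] at hr
    have hrσ : ((r.toNNReal : ℝ≥0) : WithTop ℝ≥0) ≤ σ ω := coe_toNNReal_le_of_le_untopA_min hr.2
    simp only [stoppedProcess_eq_of_le hrσ, loewnerReDrift_apply]
    rw [sq_add_sq_eq_norm_sq, bwdSLERe]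
  rw [hint, intervalIntegral.integral_neg, stoppedProcess_bwdSLERe_eq, ← hu, bwdSLERe_apply,
    re_bwdFlow_eq hU hw u, sleDriving_apply]
  ring

/-- **`1/Y^σ_t = 1/im w - ∫₀ᵗ 𝟙_{s≤σ} 2/(Yₛ Qₛ) ds`** (pathwise; `Loewner.inv_im_bwdFlow_eq` at the
stopped clock). [cite: RohdeSchramm2005, Thm 3.2 (proof, (3.11))] -/
theorem inv_stoppedProcess_bwdSLEIm_eq_integral (hw : 0 < w.im) (t : ℝ≥0) (ω : ℝ≥0 → ℝ) :
    (stoppedProcess (bwdSLEIm κ w) σ t ω)⁻¹ =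
      (w.im)⁻¹ + timeIntegral (trunc σ fun s ω ↦ -loewnerInvImDrift
        (stoppedProcess (bwdSLERe κ w) σ s ω) (stoppedProcess (bwdSLEIm κ w) σ s ω)) t ω := by
  set u : ℝ≥0 := (min (t : WithTop ℝ≥0) (σ ω)).untopA with hu
  have hU := continuous_sleDriving κ ω
  have hint : timeIntegral (trunc σ fun s ω ↦ -loewnerInvImDrift (stoppedProcess (bwdSLERe κ w) σ s ω)
      (stoppedProcess (bwdSLEIm κ w) σ s ω)) t ω =
      ∫ r in (0 : ℝ)..u, -(2 / ((bwdCentred (sleDriving κ ω) w r.toNNReal).im *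
        ‖bwdCentred (sleDriving κ ω) w r.toNNReal‖ ^ 2)) := by
    rw [timeIntegral_trunc]
    simp only [timeIntegral]
    refine intervalIntegral.integral_congr fun r hr ↦ ?_
    rw [uIcc_of_le (NNReal.coe_nonneg _)] at hr
    have hrσ : ((r.toNNReal : ℝ≥0) : WithTop ℝ≥0) ≤ σ ω := coe_toNNReal_le_of_le_untopA_min hr.2
    simp only [stoppedProcess_eq_of_le hrσ, loewnerInvImDrift_apply]
    rw [sq_add_sq_eq_norm_sq, bwdSLEIm_eq_im_bwdCentred]
  rw [hint, intervalIntegral.integral_neg, stoppedProcess_bwdSLEIm_eq, ← hu, bwdSLEIm_apply,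
    inv_im_bwdFlow_eq hU hw u]
  ring

/-- The stopped weight rate `λ · 2/Q - a · 4Y²/Q²` of the stopped pair `(X^σ, Y^σ)`. [folklore] -/
theorem bwdSLEWeightRate_stopped_eq (a lam : ℝ) {s : ℝ≥0} {ω : ℝ≥0 → ℝ} (hs : (s : WithTop ℝ≥0) ≤ σ ω) :
    lam * loewnerLogImRate (stoppedProcess (bwdSLERe κ w) σ s ω) (stoppedProcess (bwdSLEIm κ w) σ s ω) -
      a * loewnerLogDerivRate (stoppedProcess (bwdSLERe κ w) σ s ω) (stoppedProcess (bwdSLEIm κ w) σ s ω) =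
      bwdSLEWeightRate κ w a lam s ω := by
  simp only [stoppedProcess_eq_of_le hs, bwdSLEWeightRate]

/-- **`Φ^σ_t = 1 + ∫₀ᵗ 𝟙_{s≤σ} rateₛ Φ^σ_s ds`** (pathwise; `bwdSLEWeight_eq_one_add` at the stopped
clock). [cite: RohdeSchramm2005, Thm 3.2 (proof)] -/
theorem stoppedProcess_bwdSLEWeight_eq_integral (hw : 0 < w.im) (a lam : ℝ) (t : ℝ≥0) (ω : ℝ≥0 → ℝ) :
    stoppedProcess (bwdSLEWeight κ w a lam) σ t ω =
      1 + timeIntegral (trunc σ fun s ω ↦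
        (lam * loewnerLogImRate (stoppedProcess (bwdSLERe κ w) σ s ω) (stoppedProcess (bwdSLEIm κ w) σ s ω) -
          a * loewnerLogDerivRate (stoppedProcess (bwdSLERe κ w) σ s ω) (stoppedProcess (bwdSLEIm κ w) σ s ω)) *
        stoppedProcess (bwdSLEWeight κ w a lam) σ s ω) t ω := by
  set u : ℝ≥0 := (min (t : WithTop ℝ≥0) (σ ω)).untopA with hu
  have hint : timeIntegral (trunc σ fun s ω ↦
        (lam * loewnerLogImRate (stoppedProcess (bwdSLERe κ w) σ s ω) (stoppedProcess (bwdSLEIm κ w) σ s ω) -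
          a * loewnerLogDerivRate (stoppedProcess (bwdSLERe κ w) σ s ω) (stoppedProcess (bwdSLEIm κ w) σ s ω)) *
        stoppedProcess (bwdSLEWeight κ w a lam) σ s ω) t ω =
      timeIntegral (fun s ω ↦ bwdSLEWeightRate κ w a lam s ω * bwdSLEWeight κ w a lam s ω) u ω := by
    rw [timeIntegral_trunc]
    simp only [timeIntegral]
    refine intervalIntegral.integral_congr fun r hr ↦ ?_
    rw [uIcc_of_le (NNReal.coe_nonneg _)] at hr
    have hrσ : ((r.toNNReal : ℝ≥0) : WithTop ℝ≥0) ≤ σ ω := coe_toNNReal_le_of_le_untopA_min hr.2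
    simp only [stoppedProcess_eq_of_le hrσ]
    rfl
  rw [hint, stoppedProcess_bwdSLEWeight_eq, ← hu, bwdSLEWeight_eq_one_add hw a lam u ω]

/-! ### Local integrability and progressivity of the truncated coefficients -/

/-- The drift path `r ↦ -𝟙_{r≤σ} 2X_r/Q_r` is locally integrable (continuous integrand). [folklore] -/
theorem integrableOn_trunc_neg_loewnerReDrift (hw : 0 < w.im) (ω : ℝ≥0 → ℝ) (S : Set ℝ) (hS : IsCompact S) :
    IntegrableOn (fun r : ℝ ↦ trunc σ (fun s ω ↦ -loewnerReDrift (stoppedProcess (bwdSLERe κ w) σ s ω)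
      (stoppedProcess (bwdSLEIm κ w) σ s ω)) r.toNNReal ω) S := by
  refine integrableOn_trunc ?_
  have hc : Continuous fun r : ℝ ↦ -loewnerReDrift (stoppedProcess (bwdSLERe κ w) σ r.toNNReal ω)
      (stoppedProcess (bwdSLEIm κ w) σ r.toNNReal ω) :=
    (continuous_loewnerReDrift_comp
      ((continuous_stoppedProcess_bwdSLERe hw σ ω).comp continuous_real_toNNReal)
      ((continuous_stoppedProcess_bwdSLEIm hw σ ω).comp continuous_real_toNNReal)
      fun r ↦ stoppedProcess_bwdSLEIm_pos hw _ ω).neg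
  exact hc.continuousOn.integrableOn_compact hS

/-- The path `r ↦ -𝟙_{r≤σ} 2/(Y_r Q_r)` is locally integrable. [folklore] -/
theorem integrableOn_trunc_neg_loewnerInvImDrift (hw : 0 < w.im) (ω : ℝ≥0 → ℝ) (S : Set ℝ)
    (hS : IsCompact S) :
    IntegrableOn (fun r : ℝ ↦ trunc σ (fun s ω ↦ -loewnerInvImDrift
      (stoppedProcess (bwdSLERe κ w) σ s ω) (stoppedProcess (bwdSLEIm κ w) σ s ω)) r.toNNReal ω) S := by
  refine integrableOn_trunc ?_
  have hc : Continuous fun r : ℝ ↦ -loewnerInvImDrift (stoppedProcess (bwdSLERe κ w) σ r.toNNReal ω)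
      (stoppedProcess (bwdSLEIm κ w) σ r.toNNReal ω) :=
    (continuous_loewnerInvImDrift_comp
      ((continuous_stoppedProcess_bwdSLERe hw σ ω).comp continuous_real_toNNReal)
      ((continuous_stoppedProcess_bwdSLEIm hw σ ω).comp continuous_real_toNNReal)
      fun r ↦ stoppedProcess_bwdSLEIm_pos hw _ ω).neg
  exact hc.continuousOn.integrableOn_compact hS

/-- `r ↦ 2/(f² + g²)` is continuous when `f, g` are and `g > 0`. [folklore] -/
theorem continuous_loewnerLogImRate_comp {α : Type*} [TopologicalSpace α] {f g : α → ℝ}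
    (hf : Continuous f) (hg : Continuous g) (hpos : ∀ r, 0 < g r) :
    Continuous fun r ↦ loewnerLogImRate (f r) (g r) := by
  simp only [loewnerLogImRate_apply]
  exact continuous_const.div ((hf.pow 2).add (hg.pow 2)) fun r ↦ by
    have := hpos r; positivity

/-- The stopped weight-rate path times `Φ^σ` is continuous in real time. [folklore] -/
theorem continuous_weightRate_stopped_mul (hw : 0 < w.im) (a lam : ℝ) (ω : ℝ≥0 → ℝ) :
    Continuous fun r : ℝ ↦
      (lam * loewnerLogImRate (stoppedProcess (bwdSLERe κ w) σ r.toNNReal ω)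
          (stoppedProcess (bwdSLEIm κ w) σ r.toNNReal ω) -
        a * loewnerLogDerivRate (stoppedProcess (bwdSLERe κ w) σ r.toNNReal ω)
          (stoppedProcess (bwdSLEIm κ w) σ r.toNNReal ω)) *
      stoppedProcess (bwdSLEWeight κ w a lam) σ r.toNNReal ω := by
  have hX := (continuous_stoppedProcess_bwdSLERe hw σ ω (κ := κ) (w := w)).comp continuous_real_toNNReal
  have hY := (continuous_stoppedProcess_bwdSLEIm hw σ ω (κ := κ) (w := w)).comp continuous_real_toNNReal
  have hΦ := (continuous_stoppedProcess_bwdSLEWeight hw a lam σ ω (κ := κ) (w := w)).comp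
    continuous_real_toNNReal
  have hpos : ∀ r : ℝ, 0 < stoppedProcess (bwdSLEIm κ w) σ r.toNNReal ω := fun r ↦
    stoppedProcess_bwdSLEIm_pos hw _ ω
  exact ((continuous_const.mul (continuous_loewnerLogImRate_comp hX hY hpos)).sub
    (continuous_const.mul (continuous_loewnerLogDerivRate_comp hX hY hpos))).mul hΦ

/-! ### `X^σ` is an Itô process -/

/-- **The stopped real part `X^σ` is an Itô process** (`σ` a stopping time of the raw Brownian
filtration): `X^σ_t = re w + ∫₀ᵗ 𝟙_{s≤σ}(-2X_s/Q_s) ds + ∫₀ᵗ 𝟙_{s≤σ}(-√κ) dB_s`, driven by the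
canonical Brownian motion. Pathwise this is `stoppedProcess_bwdSLERe_eq_integral`; the stochastic
term is the square-integrable Itô integral of the truncated constant
(`exists_isItoIntegral_of_sq_integrable`), indistinguishable from `-√κ B^σ`
(`IsItoIntegral.ae_eq_stoppedProcess`, `isItoIntegral_const_brownian`) — verbatim the argument of
`isItoProcess_stoppedProcess_slePointRe` for the forward flow. Rohde–Schramm (2005), (3.11)
(`dx = 2x dt/(x² + y²) - dξ`, reversed time). [cite: RohdeSchramm2005, Thm 3.2 (proof, (3.11))] -/
theorem isItoProcess_stoppedProcess_bwdSLERe (hw : 0 < w.im) (hσ : IsStoppingTime brownianFiltration σ) :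
    IsItoProcess (stoppedProcess (bwdSLERe κ w) σ)
      (trunc σ fun s ω ↦ -loewnerReDrift (stoppedProcess (bwdSLERe κ w) σ s ω)
        (stoppedProcess (bwdSLEIm κ w) σ s ω))
      (trunc σ fun _ _ ↦ -Real.sqrt κ) brownian brownianFiltration preWienerMeasure := by
  haveI := isProbabilityMeasure_preWienerMeasure'
  have hσ' : ∀ t : ℝ≥0, MeasurableSet[brownianFiltration t] {ω | σ ω < t} :=
    fun t ↦ hσ.measurableSet_lt t
  refine ⟨ae_of_all _ fun ω t ↦ integrableOn_trunc_neg_loewnerReDrift hw ω _ isCompact_Icc, ?_⟩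
  have hσprog : IsStronglyProgressive brownianFiltration
      (trunc σ fun (_ : ℝ≥0) (_ : ℝ≥0 → ℝ) ↦ -Real.sqrt κ) :=
    isStronglyProgressive_trunc (isStronglyProgressive_const _ _) hσ'
  have hfin : ∀ t : ℝ≥0, ∫⁻ ω, (∫⁻ s in Set.Icc (0 : ℝ) t, ENNReal.ofReal
      ((trunc σ (fun (_ : ℝ≥0) (_ : ℝ≥0 → ℝ) ↦ -Real.sqrt κ)) s.toNNReal ω ^ 2))
      ∂preWienerMeasure ≠ ∞ := by
    intro t
    have hle : ∀ ω : ℝ≥0 → ℝ, (∫⁻ s in Set.Icc (0 : ℝ) t, ENNReal.ofReal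
        ((trunc σ (fun (_ : ℝ≥0) (_ : ℝ≥0 → ℝ) ↦ -Real.sqrt κ)) s.toNNReal ω ^ 2)) ≤
        ENNReal.ofReal κ * volume (Set.Icc (0 : ℝ) t) := by
      intro ω
      rw [← setLIntegral_const]
      refine lintegral_mono fun s ↦ ENNReal.ofReal_le_ofReal ?_
      rw [trunc_apply]
      split_ifs
      · rw [neg_sq, Real.sq_sqrt κ.coe_nonneg]
      · simp
    refine ne_top_of_le_ne_top ?_ (lintegral_mono hle)
    rw [lintegral_const, measure_univ, mul_one, Real.volume_Icc, sub_zero]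
    exact ENNReal.mul_ne_top ENNReal.ofReal_ne_top ENNReal.ofReal_ne_top
  obtain ⟨J, hJ, -, -⟩ := exists_isItoIntegral_of_sq_integrable hσprog hfin
  have hJeq := IsItoIntegral.ae_eq_stoppedProcess martingale_brownian_holds
    martingale_brownian_sq_sub_holds memLp_two_brownian continuous_brownian
    (H := fun (_ : ℝ≥0) (_ : ℝ≥0 → ℝ) ↦ -Real.sqrt κ) measurable_const hσ'
    (isItoIntegral_const_brownian (-Real.sqrt κ)) hJ
  refine ⟨J, hJ, ?_⟩
  filter_upwards [hJeq] with ω hω t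
  rw [hω t, stoppedProcess_bwdSLERe_zero hw]
  exact stoppedProcess_bwdSLERe_eq_integral hw t ω

end Stopped


end Literature.Probability.RandomPlanarGeometry
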